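import Summits.ResolutionOfSingularities.ResolutionOfSingularities.Theorems.WeakOrderReduction
import Literature.AlgebraicGeometry.Resolution.MarkedIdeals
import Literature.AlgebraicGeometry.Resolution.BlowupSequences
import HarnessLib

/-!
# LocalControlClasses — Zariski product data and the pointed order-reduction game (decomp-res node N46, phase 1)

Route-independent typed objects of the decomp-res lens-3 g8 node «LocalControl / ZariskiReduction» (critic row 53,
CLEARED AS ASIDE-RUNG MAP NODE; lens file HOME/decomp-res-lens-3/g8/LocalControl.lean rev 2 sha256
80bfde4c0653d098…, 440 lines, rc 0 · 0 sorry; WRITER.md). The node refines `MaxContactCut.RungOne` (29273,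
`E 2 → E 1` of `Theorems.WeakOrderReduction`) by the ZARISKI SLICE: data reachable from a Zariski product datum
`(Spec A[Z], (Zᵖ + f), marking p)` — the multiplicity-`p` stage of the purely inseparable hypersurface `Zᵖ + f = 0`
over a regular threefold, i.e. the statement Cossart–Piltant hope for in print (CossartPiltant2019, p.274:
«Theorem 1.5 could be extended to … a composition of Hironaka-permissible (global) blowing ups»), whose LOCAL form
is their
Thm 1.5(i) (valuation-independent local control, the «A/B game»).

This file types, over the tree's `MarkedIdeal` / `CentreSeq` / `WeakAdmissible` / `WeakResolution`:
* §1 the Zariski product datum (`ZarAmbient`, `zarIdeal`, `zarMarked`, `reachMarked`) and the `SeqDimFour` frame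
  `InFrame`;
* §2 the POINTED ORDER-REDUCTION GAME `AWins M y` (player A — global regular centres inside the support — has a finite
  winning strategy against player B — points over `y`);
* §3 STATE-ASSIGNMENTS `Assignment` (one centre per marked ideal: player A without memory), forced play `IsForcedBy`,
  and pointwise-finite forced play `ZWins`;
* §4 generic kernels: a weak resolution is a winning strategy (`aWins_of_weakResolution`), forced plays are weakly
  admissible, terminating forced plays are pointwise finite, and «the head of a SHORTEST weak resolution is a coherent
  strategy» (`exists_minimal_assignment`, by `Nat.find` on the resolution length).
No Theses import; the five route items (asides `Zar*` on MaxContactCut) inline their text over these names, and the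
by-name kernels live in `Theorems/MaxContactCutLocalControl.lean` (phase 3). 0 sorry.
-/

open CategoryTheory AlgebraicGeometry
open Literature.AlgebraicGeometry.Resolution
open Summit.ResolutionOfSingularities.ResolutionOfSingularities.Theorems.WeakOrderReduction
  (WeakAdmissible WeakResolution)

namespace Summit.ResolutionOfSingularities.ResolutionOfSingularities.Theorems.LocalControlClasses

/-! ## §1 Zariski product data and the frame -/

/-- The ambient `𝔸¹_B = Spec A[Z]` of a Zariski product datum (`B = Spec A`). DEFINITION (support). -/
noncomputable abbrev ZarAmbient (A : Type) [CommRing A] : Scheme.{0} :=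
  Spec (CommRingCat.of (Polynomial A))

/-- The ideal sheaf `(Zᵖ + f)` on `Spec A[Z]` (CossartPiltant2019, Thm 1.5 (1.1)(i)). DEFINITION (support). -/
noncomputable def zarIdeal (A : Type) [CommRing A] (p : ℕ) (f : A) : (ZarAmbient A).IdealSheafData :=
  Scheme.IdealSheafData.ofIdealTop
    (Ideal.span {(Scheme.ΓSpecIso (CommRingCat.of (Polynomial A))).inv.hom (Polynomial.X ^ p + Polynomial.C f)})

/-- The Zariski product MARKED IDEAL `(Spec A[Z], (Zᵖ + f), ∅, p)`. DEFINITION (support). -/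
noncomputable def zarMarked (A : Type) [CommRing A] (p : ℕ) (f : A) : MarkedIdeal (ZarAmbient A) :=
  ⟨zarIdeal A p f, [], p⟩

/-- The REACHED marked ideal: the controlled transform of `(Zᵖ + f, p)` along a prefix `s`, boundary forgotten (the
weak format ignores it), marking `p`. DEFINITION (support). -/
noncomputable def reachMarked (A : Type) [CommRing A] (p : ℕ) (f : A) (s : CentreSeq (ZarAmbient A)) :
    MarkedIdeal s.top :=
  ⟨(s.transformMarked (zarMarked A p f)).ideal, [], p⟩

/-- The `SeqDimFour` FRAME for a scheme `X` and an ideal sheaf `I` at order `p` over the field `k`: `X/k` separated,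
locally of finite type, quasi-compact, regular, `dim X ≤ 4`, and `ord_y I ≤ p` everywhere. DEFINITION (support). -/
def InFrame (p : ℕ) (k : Type) [Field k] (X : Scheme.{0}) (I : X.IdealSheafData) : Prop :=
  ∃ g : X ⟶ Spec (.of k), IsSeparated g ∧ LocallyOfFiniteType g ∧ QuasiCompact g ∧
    Scheme.IsRegular X ∧ topologicalKrullDim X ≤ 4 ∧ ∀ y : X, idealOrder I y ≤ ((p : ℕ) : ℕ∞)

/-! ## §2 The pointed order-reduction game -/

/-- **`AWins M y`** — player A has a FINITE WINNING STRATEGY in the pointed order-reduction game of the marked ideal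
`M` at the point `y`: either `y` is already off the support, or A plays a regular centre `C` inside the support
(a weakly admissible blow-up, GLOBAL on the current scheme) such that A wins at EVERY point `y′` of the blow-up lying
over `y` (player B's moves). The inductive definition makes every play finite along every point-branch — exactly
Cossart–Piltant's «x is resolved for m(x) = p»: for every valuation centred at x a finite INDEPENDENT sequence
(CossartPiltant2019 Def. 2.77: centres depend on the point, not on the valuation; Def 5.4, Rem 5.7) achieves m < p.
DEFINITION (the node's new object). -/
inductive AWins : ∀ {X : Scheme.{0}}, MarkedIdeal X → X → Prop
  | done {X : Scheme.{0}} {M : MarkedIdeal X} {y : X} (hy : y ∉ M.support) : AWins M y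
  | move {X : Scheme.{0}} {M : MarkedIdeal X} {y : X} (C : X.IdealSheafData)
      (hC : (C.support : Set X) ⊆ M.support) (hreg : Scheme.IsRegular C.subscheme)
      (hwin : ∀ y' : ↥(blowup C), (blowup.π C).base y' = y → AWins (M.transform (blowup.π C) C) y') :
      AWins M y

/-! ## §3 Coherent (state-dependent) strategies and forced play -/

/-- A STATE-ASSIGNMENT: one centre for every marked ideal on every scheme (player A deprived of memory and of the
point: the centre depends on the current global state only). DEFINITION (support). -/
def Assignment : Type 1 := ∀ ⦃X : Scheme.{0}⦄, MarkedIdeal X → X.IdealSheafData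

/-- `IsForcedBy Z t M`: the centre sequence `t` is the play FORCED by the assignment `Z` from the state `M`, and each
forced centre is weakly admissible when played (regular, inside the current support). DEFINITION (support). -/
def IsForcedBy (Z : Assignment) : {X : Scheme.{0}} → CentreSeq X → MarkedIdeal X → Prop
  | _, .nil _, _ => True
  | _, .cons C rest, M => C = Z M ∧ (C.support : Set _) ⊆ M.support ∧ Scheme.IsRegular C.subscheme ∧
      IsForcedBy Z rest (M.transform (blowup.π C) C)

/-- **`ZWins Z M y`** — the play forced by `Z` from `M` is FINITE ALONG EVERY POINT-BRANCH starting at `y` and its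
centres are admissible when played: `y` is off the support, or the forced centre `C = Z M` is admissible and the
forced play wins at every point over `y`. DEFINITION (support). -/
inductive ZWins (Z : Assignment) : ∀ {X : Scheme.{0}}, MarkedIdeal X → X → Prop
  | done {X : Scheme.{0}} {M : MarkedIdeal X} {y : X} (hy : y ∉ M.support) : ZWins Z M y
  | step {X : Scheme.{0}} {M : MarkedIdeal X} {y : X} (C : X.IdealSheafData) (hZ : C = Z M)
      (hC : (C.support : Set X) ⊆ M.support) (hreg : Scheme.IsRegular C.subscheme)
      (hwin : ∀ y' : ↥(blowup C), (blowup.π C).base y' = y → ZWins Z (M.transform (blowup.π C) C) y') :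
      ZWins Z M y

/-! ## §4 Generic kernels -/

section Kernels

variable {X : Scheme.{0}}

/-- Unfolding `WeakAdmissible` on a `cons`. [folklore] -/
theorem weakAdmissible_cons {C : X.IdealSheafData} {rest : CentreSeq (blowup C)} {M : MarkedIdeal X} :
    WeakAdmissible (.cons C rest) M ↔ (C.support : Set X) ⊆ M.support ∧ Scheme.IsRegular C.subscheme ∧
      WeakAdmissible rest (M.transform (blowup.π C) C) :=
  Iff.rfl

/-- Unfolding `IsForcedBy` on a `cons`. [folklore] -/
theorem isForcedBy_cons {Z : Assignment} {C : X.IdealSheafData} {rest : CentreSeq (blowup C)}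
    {M : MarkedIdeal X} :
    IsForcedBy Z (.cons C rest) M ↔ C = Z M ∧ (C.support : Set X) ⊆ M.support ∧
      Scheme.IsRegular C.subscheme ∧ IsForcedBy Z rest (M.transform (blowup.π C) C) :=
  Iff.rfl

/-- A WEAK RESOLUTION is a winning strategy for A at every point («a resolution is a strategy»). [folklore] -/
theorem aWins_of_weakResolution : ∀ {X : Scheme.{0}} (t : CentreSeq X) (M : MarkedIdeal X),
    WeakResolution t M → ∀ y : X, AWins M y
  | _, .nil _, M, h, y => AWins.done (by
      have he : ((CentreSeq.nil _).transformMarked M).support = ∅ := h.2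
      intro hy
      have hy' : y ∈ ((CentreSeq.nil _).transformMarked M).support := hy
      rw [he] at hy'
      exact hy')
  | _, .cons C rest, M, h, y => by
      have hadm := (weakAdmissible_cons).1 h.1
      have hrest : WeakResolution rest (M.transform (blowup.π C) C) := ⟨hadm.2.2, h.2⟩
      exact AWins.move C hadm.1 hadm.2.1 (fun y' _ => aWins_of_weakResolution rest _ hrest y')

/-- A forced play is weakly admissible. [folklore] -/
theorem weakAdmissible_of_isForcedBy (Z : Assignment) : ∀ {X : Scheme.{0}} (t : CentreSeq X) (M : MarkedIdeal X),
    IsForcedBy Z t M → WeakAdmissible t M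
  | _, .nil _, _, _ => trivial
  | _, .cons C rest, M, h => by
      have h' := (isForcedBy_cons).1 h
      exact (weakAdmissible_cons).2 ⟨h'.2.1, h'.2.2.1, weakAdmissible_of_isForcedBy Z rest _ h'.2.2.2⟩

/-- A terminating forced play is pointwise finite («termination ⇒ ZWins everywhere»). [folklore] -/
theorem zWins_of_isForcedBy (Z : Assignment) : ∀ {X : Scheme.{0}} (t : CentreSeq X) (M : MarkedIdeal X),
    IsForcedBy Z t M → (t.transformMarked M).support = ∅ → ∀ y : X, ZWins Z M y
  | _, .nil _, M, _, he, y => ZWins.done (by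
      intro hy
      have hy' : y ∈ ((CentreSeq.nil _).transformMarked M).support := hy
      rw [he] at hy'
      exact hy')
  | _, .cons C rest, M, h, he, y => by
      have h' := (isForcedBy_cons).1 h
      exact ZWins.step C h'.1 h'.2.1 h'.2.2.1 (fun y' _ => zWins_of_isForcedBy Z rest _ h'.2.2.2 he y')

/-- «The head of a SHORTEST weak resolution is a coherent strategy», length-graded: there is ONE state-assignment
whose forced play terminates from every state admitting a weak resolution (minimal length by `Nat.find`; the
assignment plays `⊤` — never actually played — on states without a weak resolution). [folklore] -/
theorem exists_minimal_assignment :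
    ∃ Z : Assignment, ∀ (n : ℕ) {X : Scheme.{0}} (M : MarkedIdeal X) (t : CentreSeq X),
      WeakResolution t M → t.length ≤ n →
      ∃ u : CentreSeq X, IsForcedBy Z u M ∧ (u.transformMarked M).support = ∅ := by
  classical
  let P : ∀ {X : Scheme.{0}}, MarkedIdeal X → Prop := fun M => ∃ t : CentreSeq _, WeakResolution t M
  have hlen : ∀ {X : Scheme.{0}} (M : MarkedIdeal X), P M → ∃ n : ℕ, ∃ t : CentreSeq X,
      WeakResolution t M ∧ t.length = n := fun M ⟨t, ht⟩ => ⟨t.length, t, ht, rfl⟩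
  let Z : Assignment := fun X M =>
    if h : P M then
      match (Classical.choose (Nat.find_spec (hlen M h)) : CentreSeq X) with
      | .nil _ => ⊤
      | .cons C _ => C
    else ⊤
  refine ⟨Z, ?_⟩
  intro n
  induction n with
  | zero =>
      intro X M t ht hl
      cases t with
      | nil _ => exact ⟨.nil _, trivial, ht.2⟩
      | cons C rest => simp [CentreSeq.length] at hl
  | succ n ih =>
      intro X M t ht hl
      have hP : P M := ⟨t, ht⟩
      set t₀ : CentreSeq X := Classical.choose (Nat.find_spec (hlen M hP)) with ht₀def
      have ht₀ : WeakResolution t₀ M ∧ t₀.length = Nat.find (hlen M hP) :=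
        Classical.choose_spec (Nat.find_spec (hlen M hP))
      have hmin : Nat.find (hlen M hP) ≤ t.length := Nat.find_min' (hlen M hP) ⟨t, ht, rfl⟩
      rcases ht₀' : t₀ with _ | ⟨C, rest⟩
      · have : WeakResolution (.nil X) M := by rw [← ht₀']; exact ht₀.1
        exact ⟨.nil _, trivial, this.2⟩
      · have hZ : Z M = C := by
          show (if h : P M then _ else _) = C
          rw [dif_pos hP]
          have : Classical.choose (Nat.find_spec (hlen M hP)) = CentreSeq.cons C rest := by
            rw [← ht₀def]; exact ht₀'
          simp only [this]
        have hres : WeakResolution (.cons C rest) M := by rw [← ht₀']; exact ht₀.1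
        have hadm := (weakAdmissible_cons).1 hres.1
        have hrest : WeakResolution rest (M.transform (blowup.π C) C) := ⟨hadm.2.2, hres.2⟩
        have hlrest : rest.length ≤ n := by
          have h1 : (CentreSeq.cons C rest).length = rest.length + 1 := rfl
          have h2 : t₀.length = rest.length + 1 := by rw [ht₀']; rfl
          omega
        obtain ⟨u, hu, hue⟩ := ih _ rest hrest hlrest
        exact ⟨.cons C u, (isForcedBy_cons).2 ⟨hZ.symm, hadm.1, hadm.2.1, hu⟩, hue⟩

end Kernels

end Summit.ResolutionOfSingularities.ResolutionOfSingularities.Theorems.LocalControlClasses
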